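import Literature.Computability.AlgebraicComplexity.FSV18Lemma23Discharge
import Literature.Computability.AlgebraicComplexity.DepthThreeVariableReductionProofs
import HarnessLib

/-!
# FSV 2018, Fact 19 (ToC Fact 4.4) — DISCHARGED over every field; Cor. 22 and the `Σ^kΠΣ` bullet
# of Thm. 9 closed; Thm. 9 from ONE external result (val-lit t18 g3; N1 support)

M. A. Forbes, A. Shpilka, B. L. Volk, *Succinct hitting sets and barriers to proving lower bounds
for algebraic circuits*, Theory Comput. 14 (2018) 18:1–45 (arXiv:1701.05328), §4.1: Fact 19 (= ToC
Fact 4.4, "from the survey [SY10], rank bounds of [Saxena–Seshadhri]"): for `F` computed by a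
`Σ^kΠΣ` formula of degree `d` in `X_1, …, X_N` and the `N × r` Vandermonde matrix
`(V_t)_{ij} = t^{ij}`, "`F ≠ 0` if and only if `F ∘ (V_t · (y_1, …, y_r)^T)` is non-zero" with
`r = R(k,d) + 1` seeds. The tree's named fact `FSV2018_fact19` (val-lit t18, `FSV18SuccinctGenerators.lean`)
renders it in the multilinear frame (`N = 2^n` coordinates `x_S`, `i = binIndex m`) with the
uniform seed count `r = c·k²·(⌊log₂ d⌋ + 1) + 1`, `∃ c`.

**The discharge.** The statement needs no rank bound: it is the transcendental-`β` form of
Saxena–Seshadhri's variable reduction [SaxenaSeshadhri2012, Lemma 11 / Thm. 2] ("the field doesn't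
matter": `x_i ↦ Σ_{j ≤ k} β^{ij} y_j` keeps a nonzero `ΣΠΣ(k,d,n)` circuit nonzero for all but
`d n k²` values of `β`), which the tree PROVES in `DepthThreeVariableReductionProofs.lean`
(`SaxenaSeshadhri.aeval_vandermonde_generic_ne_zero`: with `t` an indeterminate,
`x_i ↦ Σ_{j<k} t^{(i+1)(j+1)} y_j` maps a nonzero affine `ΣΠΣ(k,d,n)` circuit to a nonzero element
of `F[t][y_1, …, y_k]`, over EVERY field). Here (theorems only; no definitions, no named facts):

* `isHittingSetGenerator_vdmGenCoeff_spsk` — the Vandermonde map with only `k` seeds `y_j` (and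
  the formal `t`) is a hitting-set generator for `Σ^kΠΣ` formulas of degree `d` in the `2^n`
  multilinear-coefficient variables: SS12's theorem transported along the binary order
  `multilinearMonomials n ≃ Fin (2^n)` (`binIndex = index + 1`, `binIndex_eq_binaryOrder_symm_succ`)
  and the identification `F[y ⊔ {t}] → F[t][y]`;
* `isHittingSetGenerator_vdmGenCoeff_mono` / `…_spsk_of_le` — more seeds never hurt (set the extra
  `y_j` to `0`), so EVERY `r ≥ k` works: this covers both printed clauses of Fact 19
  (`R(k,d) = k²` over infinite fields, `R(k,d) = O(k² log d)` over finite fields) and is the reason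
  the typed uniform clause holds with the witness `c = 1`;
* **`FSV2018_fact19_holds : FSV2018_fact19`** — the named fact DISCHARGED;
* **`FSV2018_cor22_holds`**, **`FSV2018_thm9_spsk_holds`** (t18's `FSV2018_cor22_of_fact19`,
  `FSV2018_thm9_spsk_of_cor22`): Cor. 22 (= ToC Cor. 4.7) and the `Σ^kΠΣ` bullet of Thm. 9 are
  closed theorems;
* **`FSV2018_thm9_of_thm48 : FSV2018_thm48 → FSV2018_thm9`** (p1's `FSV2018_thm9_of_twoFacts`):
  the LOAD-BEARING `FSV2018_thm9` now hangs on ONE printed external result, Thm. 48 (= ToC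
  Thm. 5.24, [ASSS16]'s depth-`D` occur-`k` theorem).

Honest framing: glue over kernel-checked proofs of printed lemmas (the mathematics is
[SaxenaSeshadhri2012]'s, proved in the tree by the `DepthThreeVariableReduction` files); the
results are UNCONDITIONAL hitting-set generators against the RESTRICTED class `Σ^kΠΣ`; `VP ≠ VNP`
is NOT proved and nothing here is progress on it.

## References

* [ForbesShpilkaVolk2018] Forbes–Shpilka–Volk, ToC 14(18) 2018 / arXiv:1701.05328: Fact 19,
  Cor. 22, Thm. 9 (seq.) = ToC Fact 4.4, Cor. 4.7, Thm. 1.10. locator: paper:arxiv-1701.05328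
  p0016.txt:L54–L80.
* [SaxenaSeshadhri2012] N. Saxena, C. Seshadhri, *Blackbox identity testing for bounded top-fanin
  depth-3 circuits: the field doesn't matter*, SIAM J. Comput. 41 (2012) / STOC 2011 /
  arXiv:1011.3234: Lemma 7 (§3.2), Lemma 11 and Claim 12 (§4.2), Thm. 2. locator:
  paper:arxiv-1011.3234 p0011 (Lemma 7), p0014 (Lemma 11).
-/

noncomputable section

namespace Literature.Computability.AlgebraicComplexity

open MvPolynomial Finset Literature.Barriers.ValiantsHypothesis

/-! ## More seeds never hurt -/

/-- **Monotonicity in the seed count:** if the Vandermonde map `X_i ↦ Σ_{j<k} y_j t^{(j+1)i}` with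
`k` seeds is a hitting-set generator for a class `𝒟`, so is the one with `r ≥ k` seeds (the
substitution `y_j ↦ 0` for `j ≥ k` maps the `r`-seed composition `D ∘ V` onto the `k`-seed one).
[cite: ForbesShpilkaVolk2018, Fact 19 (seq.) = ToC Fact 4.4 ("for `r = R(k,d)+1`")] -/
theorem isHittingSetGenerator_vdmGenCoeff_mono {F : Type*} [CommRing F] {n k r : ℕ}
    {𝒟 : Set (MvPolynomial (multilinearMonomials n) F)} (hkr : k ≤ r)
    (h : IsHittingSetGenerator 𝒟
      (fun m : multilinearMonomials n => vdmGenCoeff F n k (m : Fin n →₀ ℕ))) :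
    IsHittingSetGenerator 𝒟
      (fun m : multilinearMonomials n => vdmGenCoeff F n r (m : Fin n →₀ ℕ)) := by
  classical
  intro D hD hD0 h0
  -- the projection onto the first `k` seeds: `y_j ↦ y_j` (`j < k`), `y_j ↦ 0` (`j ≥ k`), `t ↦ t`
  set π : MvPolynomial (Fin r ⊕ Unit) F →ₐ[F] MvPolynomial (Fin k ⊕ Unit) F :=
    aeval (Sum.elim (fun j : Fin r => if hj : (j : ℕ) < k then X (Sum.inl ⟨j, hj⟩) else 0)
      fun u => X (Sum.inr u)) with hπdef
  have hπ : ∀ m : Fin n →₀ ℕ, π (vdmGenCoeff F n r m) = vdmGenCoeff F n k m := by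
    intro m
    set f : ℕ → MvPolynomial (Fin k ⊕ Unit) F := fun j =>
      (if hj : j < k then X (Sum.inl ⟨j, hj⟩) else 0) *
        X (Sum.inr ()) ^ ((j + 1) * binIndex m) with hf
    have hl : π (vdmGenCoeff F n r m) = ∑ j ∈ Finset.range r, f j := by
      rw [vdmGenCoeff, map_sum, ← Fin.sum_univ_eq_sum_range]
      refine Finset.sum_congr rfl fun j _ => ?_
      simp only [map_mul, map_pow, hπdef, aeval_X, Sum.elim_inl, Sum.elim_inr, hf]
    have hr : vdmGenCoeff F n k m = ∑ j ∈ Finset.range k, f j := by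
      rw [vdmGenCoeff, ← Fin.sum_univ_eq_sum_range]
      refine Finset.sum_congr rfl fun j _ => ?_
      simp only [hf, dif_pos j.2, Fin.eta]
    rw [hl, hr]
    exact (Finset.sum_subset (Finset.range_mono hkr) fun j _ hj => by
      have hjk : ¬ j < k := fun h' => hj (Finset.mem_range.2 h')
      simp only [hf, dif_neg hjk, zero_mul]).symm
  have hcomp : π.comp (bind₁ fun m : multilinearMonomials n => vdmGenCoeff F n r (m : Fin n →₀ ℕ)) =
      bind₁ fun m : multilinearMonomials n => vdmGenCoeff F n k (m : Fin n →₀ ℕ) := by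
    refine MvPolynomial.algHom_ext fun m => ?_
    simp only [AlgHom.comp_apply, bind₁_X_right, hπ]
  refine h D hD hD0 ?_
  have h1 := AlgHom.congr_fun hcomp D
  rw [AlgHom.comp_apply, h0, map_zero] at h1
  exact h1.symm

/-! ## Fact 19 with `k` seeds: Saxena–Seshadhri's variable reduction in FSV's frame -/

/-- **[SaxenaSeshadhri2012, Lemma 11] in the multilinear frame (PROVED):** over EVERY field, the
Vandermonde map `X_i ↦ Σ_{j=1}^{k} y_j t^{ij}` (`i = binIndex m ∈ [2^n]`, formal `t`, only `k`
seeds) is a hitting-set generator for `Σ^kΠΣ` formulas of degree `d` in the `N = 2^n` coefficient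
variables: the tree's `SaxenaSeshadhri.aeval_vandermonde_generic_ne_zero` (variables `Fin (2^n)`,
exponent `(i+1)(j+1)`, values in `F[t][y]`) transported along the binary order
(`binIndex = index + 1`) and `F[y, t] → F[t][y]`.
[cite: SaxenaSeshadhri2012, Lemma 11 and Theorem 2] [cite: ForbesShpilkaVolk2018, Fact 19 (seq.) = ToC Fact 4.4] -/
theorem isHittingSetGenerator_vdmGenCoeff_spsk (F : Type*) [Field F] (n k d : ℕ) :
    IsHittingSetGenerator (spskClass F (multilinearMonomials n) k d)
      (fun m : multilinearMonomials n => vdmGenCoeff F n k (m : Fin n →₀ ℕ)) := by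
  classical
  rintro D ⟨dd, ℓ, hdd, hℓ, rfl⟩ hD0 h0
  -- the binary order: `binIndex m = e m + 1`
  obtain ⟨e, he⟩ : ∃ e : multilinearMonomials n ≃ Fin (2 ^ n),
      ∀ m : multilinearMonomials n, binIndex (m : Fin n →₀ ℕ) = (e m : ℕ) + 1 :=
    ⟨(binaryOrder n).symm, binIndex_eq_binaryOrder_symm_succ⟩
  -- the renamed circuit is a nonzero affine `ΣΠΣ(k, d, 2^n)` circuit
  have hℓ' : ∀ i j, (rename e (ℓ i j)).totalDegree ≤ 1 := fun i j =>
    (totalDegree_rename_le _ _).trans (hℓ i j)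
  have hre : rename e (∑ i, ∏ j, ℓ i j) = ∑ i, ∏ j, rename e (ℓ i j) := by
    simp only [map_sum, map_prod]
  have hC' : (∑ i, ∏ j, rename e (ℓ i j)) ≠ 0 := by
    rw [← hre]
    exact fun h' => hD0 (rename_injective _ e.injective (h'.trans (map_zero _).symm))
  have hSS := SaxenaSeshadhri.aeval_vandermonde_generic_ne_zero dd hdd
    (fun i j => rename e (ℓ i j)) hℓ' hC'
  -- `θ : F[y, t] → F[t][y]`
  set θ : MvPolynomial (Fin k ⊕ Unit) F →ₐ[F] MvPolynomial (Fin k) (Polynomial F) :=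
    aeval (Sum.elim (fun j : Fin k => (X j : MvPolynomial (Fin k) (Polynomial F)))
      fun _ => C Polynomial.X) with hθdef
  have hθ : ∀ m : multilinearMonomials n, θ (vdmGenCoeff F n k (m : Fin n →₀ ℕ)) =
      ∑ j : Fin k, C (Polynomial.X ^ (((e m : ℕ) + 1) * ((j : ℕ) + 1)) : Polynomial F) * X j := by
    intro m
    rw [vdmGenCoeff, map_sum]
    refine Finset.sum_congr rfl fun j _ => ?_
    rw [map_mul, map_pow, he m, Nat.mul_comm ((e m : ℕ) + 1) ((j : ℕ) + 1)]
    simp only [hθdef, aeval_X, Sum.elim_inl, Sum.elim_inr]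
    rw [← C_pow]
    exact mul_comm _ _
  have hcomp : θ.comp (bind₁ fun m : multilinearMonomials n => vdmGenCoeff F n k (m : Fin n →₀ ℕ)) =
      (aeval fun i : Fin (2 ^ n) => ∑ j : Fin k,
        C (Polynomial.X ^ ((i.1 + 1) * (j.1 + 1)) : Polynomial F) * X j).comp (rename e) := by
    refine MvPolynomial.algHom_ext fun m => ?_
    simp only [AlgHom.comp_apply, bind₁_X_right, hθ, rename_X, aeval_X]
  apply hSS
  have h1 := AlgHom.congr_fun hcomp (∑ i, ∏ j, ℓ i j)
  rw [AlgHom.comp_apply, AlgHom.comp_apply, h0, map_zero, hre] at h1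
  exact h1.symm

/-- **Fact 19 for every seed count `r ≥ k` (PROVED):** both printed clauses ("`r = R(k,d)+1` where
`R(k,d) = O(k² log d)` (over finite fields) or `R(k,d) = k²` (over infinite fields)") and more —
any `r ≥ k` seeds, over every field. [cite: ForbesShpilkaVolk2018, Fact 19 (seq.) = ToC Fact 4.4]
[cite: SaxenaSeshadhri2012, Theorem 2] -/
theorem isHittingSetGenerator_vdmGenCoeff_spsk_of_le (F : Type*) [Field F] (n k d : ℕ) {r : ℕ}
    (hkr : k ≤ r) :
    IsHittingSetGenerator (spskClass F (multilinearMonomials n) k d)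
      (fun m : multilinearMonomials n => vdmGenCoeff F n r (m : Fin n →₀ ℕ)) :=
  isHittingSetGenerator_vdmGenCoeff_mono hkr (isHittingSetGenerator_vdmGenCoeff_spsk F n k d)

/-! ## The named fact and its consequences -/

/-- **FSV Fact 19 (ToC Fact 4.4) — DISCHARGED:** the named fact `FSV2018_fact19` holds, with the
witness `c = 1` (`r = k²(⌊log₂ d⌋+1) + 1 ≥ k` seeds). [cite: ForbesShpilkaVolk2018, Fact 19 (seq.) = ToC Fact 4.4]
[cite: SaxenaSeshadhri2012, Lemma 11 and Theorem 2] -/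
theorem FSV2018_fact19_holds : FSV2018_fact19 := by
  refine ⟨1, fun F _ n k d => ?_⟩
  have hkr : k ≤ 1 * k ^ 2 * (Nat.log 2 d + 1) + 1 :=
    calc k ≤ k ^ 2 := Nat.le_self_pow two_ne_zero k
      _ ≤ k ^ 2 * (Nat.log 2 d + 1) := Nat.le_mul_of_pos_right _ (Nat.succ_pos _)
      _ = 1 * k ^ 2 * (Nat.log 2 d + 1) := by rw [one_mul]
      _ ≤ 1 * k ^ 2 * (Nat.log 2 d + 1) + 1 := Nat.le_succ _
  exact isHittingSetGenerator_vdmGenCoeff_spsk_of_le F n k d hkr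

/-- **FSV Cor. 22 (ToC Cor. 4.7) — DISCHARGED:** the succinct rank condenser `G^{RC}_{n,r}` is a
`poly(k, log d, n)`-`ΣΠΣ` succinct hitting-set generator for `Σ^kΠΣ` formulas (t18's
`FSV2018_cor22_of_fact19` fed with `FSV2018_fact19_holds`).
[cite: ForbesShpilkaVolk2018, Cor. 22 (seq.) = ToC Cor. 4.7] -/
theorem FSV2018_cor22_holds : FSV2018_cor22 :=
  FSV2018_cor22_of_fact19 FSV2018_fact19_holds

/-- **FSV Thm. 9, the `Σ^kΠΣ` bullet (ToC Thm. 1.10) — DISCHARGED** (t18's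
`FSV2018_thm9_spsk_of_cor22`). [cite: ForbesShpilkaVolk2018, Thm. 9 (seq.) = ToC Thm. 1.10] -/
theorem FSV2018_thm9_spsk_holds : FSV2018_thm9_spsk :=
  FSV2018_thm9_spsk_of_cor22 FSV2018_cor22_holds

/-- **FSV Thm. 9 (ToC Thm. 1.10) from ONE external result:** the LOAD-BEARING `FSV2018_thm9` hangs
on Thm. 48 (= ToC Thm. 5.24, [ASSS16]'s depth-`D` occur-`k` theorem) alone (p1's
`FSV2018_thm9_of_twoFacts` fed with `FSV2018_fact19_holds`).
[cite: ForbesShpilkaVolk2018, Thm. 9 (seq.) = ToC Thm. 1.10] -/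
theorem FSV2018_thm9_of_thm48 (h48 : FSV2018_thm48) : FSV2018_thm9 :=
  FSV2018_thm9_of_twoFacts FSV2018_fact19_holds h48



end Literature.Computability.AlgebraicComplexity
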